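import Mathlib
import HarnessLib

/-!
# Thin against good: averaging a pointwise comparison with a logarithmic loss

(Line `janus-bands`, crux `ArrangementNormalForm`, stub `stub_separateTwo`, part `ThinGood`.)
The one-variable bookkeeping of the `stub_separateTwo` roadmap. (1) AVERAGING
(`thin_le_good`): if `f u ≤ A u · g u'` for all `u` in the thin set `T` and `u'` in the good set
`S`, then `vol(S) · ∫_T f ≤ (∫_T A) · ∫_S g`. (2) The LOGARITHMIC LOSS of the window
contractions is integrable (`lintegral_logpow_le`, registered as `separateTwo_thinGood`):
`∫⁻_{(0,η)} (1 + log(η/u))^m du ≤ 2 (1+2m)^m η`, via the pointwise bound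
`(1 + log X)^m ≤ (1+2m)^m X^{1/2}` for `X ≥ 1` (`one_add_log_pow_le`) and `∫_0^η (η/u)^{1/2} = 2η`.
With `A u = C (1 + log(η/u))^{m}` (the constant of `SepTwo.lmass_contract` for the contraction
factor `s = u/η`), (1)+(2) give `∫_thin F ≤ C' ∫_good F` at every abscissa/radius.
-/

noncomputable section

open Set MeasureTheory
open scoped ENNReal

namespace Summit.KontsevichZagierPeriods.ArrangementNormalForm.JanusBands

namespace SepTwo

/-- **Averaging a pointwise comparison.** -/
theorem thin_le_good {T S : Set ℝ} (hT : MeasurableSet T) (hSm : MeasurableSet S)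
    (hS : volume S ≠ ∞) (f g A : ℝ → ℝ≥0∞) (hg : AEMeasurable g (volume.restrict S))
    (hA : Measurable A) (hfg : ∀ u ∈ T, ∀ u' ∈ S, f u ≤ A u * g u') :
    volume S * ∫⁻ u in T, f u ≤ (∫⁻ u in T, A u) * ∫⁻ u' in S, g u' := by
  have hpt : ∀ u ∈ T, f u * volume S ≤ A u * ∫⁻ u' in S, g u' := by
    intro u hu
    calc f u * volume S = ∫⁻ _u' in S, f u := (setLIntegral_const S (f u)).symm
      _ ≤ ∫⁻ u' in S, A u * g u' := setLIntegral_mono' hSm fun u' hu' => hfg u hu u' hu'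
      _ = A u * ∫⁻ u' in S, g u' := lintegral_const_mul'' _ hg
  calc volume S * ∫⁻ u in T, f u = (∫⁻ u in T, f u) * volume S := mul_comm _ _
    _ = ∫⁻ u in T, f u * volume S := (lintegral_mul_const' _ _ hS).symm
    _ ≤ ∫⁻ u in T, A u * ∫⁻ u' in S, g u' := setLIntegral_mono' hT hpt
    _ = (∫⁻ u in T, A u) * ∫⁻ u' in S, g u' := lintegral_mul_const'' _ hA.aemeasurable

/-- `(1 + log X)^m ≤ (1 + 2m)^m · X^{1/2}` for `X ≥ 1`. -/
theorem one_add_log_pow_le (m : ℕ) {X : ℝ} (hX : 1 ≤ X) :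
    (1 + Real.log X) ^ m ≤ (1 + 2 * m) ^ m * X ^ (1 / 2 : ℝ) := by
  have hX0 : 0 < X := by linarith
  have hlog0 : 0 ≤ Real.log X := Real.log_nonneg hX
  rcases Nat.eq_zero_or_pos m with hm | hm
  · subst hm
    simpa using Real.one_le_rpow hX (by norm_num : (0 : ℝ) ≤ 1 / 2)
  have hm' : (0 : ℝ) < m := by exact_mod_cast hm
  set a : ℝ := 1 / (2 * m) with ha
  have ha0 : 0 < a := by rw [ha]; positivity
  have hXa : 1 ≤ X ^ a := Real.one_le_rpow hX ha0.le
  have hlog : Real.log X = 2 * m * Real.log (X ^ a) := by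
    rw [Real.log_rpow hX0, ha]; field_simp
  have h1 : Real.log (X ^ a) ≤ X ^ a - 1 := Real.log_le_sub_one_of_pos (Real.rpow_pos_of_pos hX0 a)
  have h2 : 1 + Real.log X ≤ (1 + 2 * m) * X ^ a := by
    rw [hlog]; nlinarith
  have h3 : (1 + Real.log X) ^ m ≤ ((1 + 2 * m) * X ^ a) ^ m :=
    pow_le_pow_left₀ (by linarith) h2 m
  have h4 : (X ^ a) ^ m = X ^ (1 / 2 : ℝ) := by
    rw [← Real.rpow_natCast, ← Real.rpow_mul hX0.le, ha]
    congr 1; field_simp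
  calc (1 + Real.log X) ^ m ≤ ((1 + 2 * m) * X ^ a) ^ m := h3
    _ = (1 + 2 * m) ^ m * X ^ (1 / 2 : ℝ) := by rw [mul_pow, h4]

/-- `∫_{(0,η)} (η/u)^{1/2} du = 2η`. -/
theorem integral_sqrt_ratio {η : ℝ} (hη : 0 < η) :
    ∫ u in Ioo 0 η, (η / u) ^ (1 / 2 : ℝ) = 2 * η := by
  have hcongr : EqOn (fun u : ℝ => (η / u) ^ (1 / 2 : ℝ))
      (fun u => η ^ (1 / 2 : ℝ) * u ^ (-(1 / 2) : ℝ)) (Ioo 0 η) := fun u hu => by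
    simp only
    rw [Real.div_rpow hη.le hu.1.le, Real.rpow_neg hu.1.le]
    ring
  rw [setIntegral_congr_fun measurableSet_Ioo hcongr, integral_const_mul]
  have hI : ∫ a in Ioo 0 η, a ^ (-(1 / 2) : ℝ) = 2 * η ^ (1 / 2 : ℝ) := by
    rw [← integral_Ioc_eq_integral_Ioo, ← intervalIntegral.integral_of_le hη.le,
      integral_rpow (Or.inl (by norm_num))]
    have e : (-(1 / 2) : ℝ) + 1 = 1 / 2 := by norm_num
    rw [e, Real.zero_rpow (by norm_num)]
    ring
  have h : η ^ (1 / 2 : ℝ) * η ^ (1 / 2 : ℝ) = η := by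
    rw [← Real.rpow_add hη]; norm_num
  rw [hI, show η ^ (1 / 2 : ℝ) * (2 * η ^ (1 / 2 : ℝ)) = 2 * (η ^ (1 / 2 : ℝ) * η ^ (1 / 2 : ℝ)) by ring,
    h]

/-- **The logarithmic loss is integrable.** `∫⁻_{(0,η)} (1 + log(η/u))^m ≤ 2 (1+2m)^m η`. -/
theorem lintegral_logpow_le (m : ℕ) {η : ℝ} (hη : 0 < η) :
    ∫⁻ u in Ioo 0 η, ENNReal.ofReal ((1 + Real.log (η / u)) ^ m) ≤
      ENNReal.ofReal (2 * (1 + 2 * m) ^ m * η) := by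
  have hb : ∀ u ∈ Ioo (0 : ℝ) η,
      (1 + Real.log (η / u)) ^ m ≤ (1 + 2 * m) ^ m * (η / u) ^ (1 / 2 : ℝ) := fun u hu =>
    one_add_log_pow_le m ((one_le_div hu.1).2 hu.2.le)
  have hint : IntegrableOn (fun u : ℝ => (1 + 2 * (m : ℝ)) ^ m * (η / u) ^ (1 / 2 : ℝ)) (Ioo 0 η) := by
    have h1 : IntegrableOn (fun u : ℝ => u ^ (-(1 / 2) : ℝ)) (Ioo 0 η) :=
      (intervalIntegral.integrableOn_Ioo_rpow_iff hη).2 (by norm_num)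
    have h2 : IntegrableOn (fun u : ℝ => (1 + 2 * (m : ℝ)) ^ m * (η ^ (1 / 2 : ℝ) * u ^ (-(1 / 2) : ℝ)))
        (Ioo 0 η) := (h1.const_mul _).const_mul _
    refine h2.congr_fun (fun u hu => ?_) measurableSet_Ioo
    show (1 + 2 * (m : ℝ)) ^ m * (η ^ (1 / 2 : ℝ) * u ^ (-(1 / 2) : ℝ)) =
      (1 + 2 * (m : ℝ)) ^ m * (η / u) ^ (1 / 2 : ℝ)
    rw [Real.div_rpow hη.le hu.1.le, Real.rpow_neg hu.1.le]
    ring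
  calc ∫⁻ u in Ioo 0 η, ENNReal.ofReal ((1 + Real.log (η / u)) ^ m)
      ≤ ∫⁻ u in Ioo 0 η, ENNReal.ofReal ((1 + 2 * m) ^ m * (η / u) ^ (1 / 2 : ℝ)) :=
        setLIntegral_mono' measurableSet_Ioo fun u hu => ENNReal.ofReal_le_ofReal (hb u hu)
    _ = ENNReal.ofReal (∫ u in Ioo 0 η, (1 + 2 * (m : ℝ)) ^ m * (η / u) ^ (1 / 2 : ℝ)) := by
        rw [ofReal_integral_eq_lintegral_ofReal hint]
        filter_upwards [ae_restrict_mem measurableSet_Ioo] with u hu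
        exact mul_nonneg (by positivity) (Real.rpow_nonneg (div_nonneg hη.le hu.1.le) _)
    _ = ENNReal.ofReal (2 * (1 + 2 * m) ^ m * η) := by
        rw [integral_const_mul, integral_sqrt_ratio hη]; ring_nf

end SepTwo

/-- **The logarithmic loss of the window contractions is integrable** (registered sub-goal of
`stub_separateTwo`; literal form of `SepTwo.lintegral_logpow_le`). -/
theorem separateTwo_thinGood (m : ℕ) (η : ℝ) (hη : 0 < η) : MeasureTheory.lintegral (MeasureTheory.volume.restrict (Set.Ioo 0 η)) (fun u => ENNReal.ofReal ((1 + Real.log (η / u)) ^ m)) ≤ ENNReal.ofReal (2 * (1 + 2 * m) ^ m * η) := by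
  exact SepTwo.lintegral_logpow_le m hη

end Summit.KontsevichZagierPeriods.ArrangementNormalForm.JanusBands
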